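import Summits.BirchSwinnertonDyer.BirchSwinnertonDyer.Theorems.SemiOrdinaryEisensteinDescentWildSplitEisensteinValueAtOneVLIdle
import Literature.NumberTheory.EllipticCurves.KrizLi2019.HeegnerLogCongruence
import Literature.NumberTheory.EllipticCurves.ModularityVersionApProofs
import Literature.NumberTheory.EllipticCurves.Rank1Residual.Predicates
import HarnessLib

/-!
# Route `SemiOrdinaryEisensteinDescent`, crux #2″ `WildSplitEisensteinValueAtOneV` (stmt-BirchSwinnertonDyer-26610, `E_𝟙^V`):
# the CONGRUENCE CERTIFICATE — Kriz–Li 2019 Thm. 1.16 transports L-idleness along a mod-3 congruence, and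
# L-idle data satisfy the crux with no further input
# (cell `pub/bsd-wall`, width seat `bsd-wall-soed-p1-w3` g16, `--supports stmt-BirchSwinnertonDyer-26610`, helper)

WHAT. p626684 (`…WildSplitEisensteinValueAtOneVLIdle`) showed that the conclusion of `E_𝟙^V` holds OUTRIGHT at every
datum with `‖log_ω P / c‖₃ ≥ 1` (L-idle). Kriz–Li, *Goldfeld's conjecture and congruences between Heegner points*,
Forum Math. Sigma 7 (2019) e15, Thm. 1.16 with Rem. 1.17 — in the tree as the named (refereed) Literature fact
`KrizLi2019.thm116_padicLogHeegner_congruence`, `m = 1`, ANY reduction at `p`, `p` SPLIT in `K` — says that for two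
curves `W`, `G` with `W[3]^ss ≅ G[3]^ss` (Dirichlet coefficients congruent mod 3 off `3·N_W·N_G`) and a common
Heegner field `K` with `3` split, the Euler-depleted normalised logarithms of the two Heegner points are congruent
mod `3`: `‖e_W·log_{ω_W}P/c_W − ε·e_G·log_{ω_G}P′/c_G‖₃ ≤ 3⁻¹`, `ε = ±1`. Hence (ultrametric inequality): if the
`G`-side quantity is a `3`-adic UNIT and the `W`-side Euler factor `e_W = ∏_{ℓ ∣ 3N_WN_G/M} |W̃^ns(𝔽_ℓ)|/ℓ` has
`‖e_W‖₃ ≤ 1`, then `‖log_{ω_W}P/c_W‖₃ ≥ 1` — the `W`-datum is L-idle, and `E_𝟙^V` holds there for every frame.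
On the wild split cell the setting is exactly Kriz–Li's: `3 ∣ N_W` (additive) splits in `K` by the Heegner
hypothesis, and the crux's embedding `embAt K 3 𝔭` is a `K →+* ℚ_3`.

* §1 (any `p`, algebra in `ℚ_p`): `one_le_norm_of_norm_sub_mul_le_inv` (a quantity congruent mod `p` to `±`a unit has
  norm `≥ 1`); `one_le_norm_of_norm_le_one_of_one_le_norm_mul` (`‖e‖ ≤ 1`, `‖e·z‖ ≥ 1 ⟹ ‖z‖ ≥ 1`).
* §2 `lIdle_of_thm116_of_congruentPartner` — at a cell datum `(W, K, Dt, H, ι, P)` (binders of the crux, level freed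
  by `N_W = N`), a partner `(G, D′, H′, P′)` congruent mod `3`, Heegner for `K`, with `G`-side unit bit and
  `‖e_W‖₃ ≤ 1`, GIVES `1 ≤ ‖log_ω P/c‖` (the L-idle binder of p626684), from the named fact `h116`.
* §4 `valueAtOneV_of_thm116_of_certificate_or_residue` — the crux BY NAME from `h116` and the per-datum display
  «congruence certificate ∨ the inequality itself» (pure logic over §3; the second disjunct is the research residue).
* §3 `valueAtOneV_datum_of_thm116_of_congruentPartner` — the crux's conclusion at that datum for EVERY frame
  `(κ, γ, 𝔭′, ι′, Ω, 𝓛, u, f)` (the crux's remaining binders verbatim), by §2 ∘ `WildSplitEisensteinValueAtOneVLIdle.valueAtOneV_on_lIdle`.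

HONEST STATUS. A per-PAIR road (one congruent partner with a known unit bit per datum), the L-currency twin of the
per-pair Kolyvagin certificate (p621234/p623400); CONDITIONAL on the refereed fact `h116` only (a `conditional-result`
in the gate's sense; the fact is print, Thm. 1.16 verbatim at `m = 1`). NOT a class-wide engine: at an index-excess
datum `y_K ∈ 3·E(K) + E(K)_tors` (no `3`-torsion under `ρ̄₃` onto), so `log_ω y_K = 3·log_ω Q`, and wherever `log_ω` is
`3`-integral on `E(K_𝔭)` (e.g. `3 ∤ c₃(E)`) such a datum is L-excess for `3 ∤ c` — no partner can make it L-idle; the research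
content of crux #2″ stays on the L-excess data (p626684 `valueAtOneV_iff_lExcess`). Supports, does not close,
stmt-BirchSwinnertonDyer-26610. BSD is not proved for any curve by any of this.
-/

noncomputable section

open scoped Classical

set_option linter.dupNamespace false -- `Summit.BirchSwinnertonDyer.BirchSwinnertonDyer.Theorems.…` (summit = sub, D-0017)
set_option autoImplicit false

namespace Summit.BirchSwinnertonDyer.BirchSwinnertonDyer.Theorems.WildSplitEisensteinValueAtOneVKrizLiTransport

open WeierstrassCurve NumberField IsDedekindDomain Field PowerSeries
  Literature.NumberTheory.EllipticCurves
  Literature.NumberTheory.EllipticCurves.ModularForms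
  Literature.NumberTheory.EllipticCurves.Rank1Residual
  Literature.NumberTheory.EllipticCurves.KrizLi2019
  Summit.BirchSwinnertonDyer.Rank1Residual
  Summit.BirchSwinnertonDyer.Rank1Residual.Additive
  Summit.BirchSwinnertonDyer.Rank1Residual.X11b
  Summit.BirchSwinnertonDyer.Rank1Residual.X11b.Halves
  Summit.BirchSwinnertonDyer.BirchSwinnertonDyer.Theses.SemiOrdinaryEisensteinDescent
  Summit.BirchSwinnertonDyer.BirchSwinnertonDyer.Theorems

/-! ### §1 Algebra in `ℚ_p` -/

section Algebra

variable {p : ℕ} [Fact p.Prime]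

/-- **A quantity congruent mod `p` to `±` a `p`-adic unit has norm `≥ 1`.** If `‖Y‖ = 1`, `ε = ±1` and
`‖X − ε·Y‖ ≤ p⁻¹`, then `‖X‖ ≥ 1` (ultrametric: `‖εY‖ ≤ max ‖X‖ ‖X − εY‖`, and both would be `< 1`). [folklore] -/
theorem one_le_norm_of_norm_sub_mul_le_inv {X Y : ℚ_[p]} {ε : ℤ} (hε : ε = 1 ∨ ε = -1) (hY : ‖Y‖ = 1)
    (h : ‖X - (ε : ℚ_[p]) * Y‖ ≤ (p : ℝ)⁻¹) : 1 ≤ ‖X‖ := by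
  by_contra hlt
  rw [not_le] at hlt
  have hεn : ‖(ε : ℚ_[p])‖ = 1 := by
    rcases hε with rfl | rfl
    · simp
    · simp
  have h1 : ‖(ε : ℚ_[p]) * Y‖ = 1 := by rw [norm_mul, hεn, hY, one_mul]
  have hp : (p : ℝ)⁻¹ < 1 := inv_lt_one_of_one_lt₀ (by exact_mod_cast (Fact.out : p.Prime).one_lt)
  have key : ‖(ε : ℚ_[p]) * Y‖ ≤ max ‖X‖ ‖-(X - (ε : ℚ_[p]) * Y)‖ := by
    have hna := Padic.nonarchimedean X (-(X - (ε : ℚ_[p]) * Y))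
    rwa [show X + -(X - (ε : ℚ_[p]) * Y) = (ε : ℚ_[p]) * Y by ring] at hna
  rw [norm_neg, h1] at key
  exact absurd key (not_le.mpr (max_lt hlt (lt_of_le_of_lt h hp)))

/-- `‖e‖ ≤ 1` and `‖e·z‖ ≥ 1` force `‖z‖ ≥ 1` (`1 ≤ ‖e‖‖z‖ ≤ ‖z‖`). [folklore] -/
theorem one_le_norm_of_norm_le_one_of_one_le_norm_mul {e z : ℚ_[p]} (he : ‖e‖ ≤ 1) (h : 1 ≤ ‖e * z‖) :
    1 ≤ ‖z‖ := by
  rw [norm_mul] at h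
  exact h.trans (mul_le_of_le_one_left (norm_nonneg z) he)

end Algebra

/-! ### §2 L-idleness of a cell datum from a congruent partner with a unit bit (Kriz–Li Thm. 1.16 by name) -/

/-- **The congruence certificate.** At a datum of the wild split cell — `W` with `ClassO6 W 3` (so `3 ∣ N_W`), level
`N = N_W`, `K` imaginary quadratic Heegner for `N` (so `3` splits in `K`), parametrisation `Dt`, Heegner datum `H`,
`ι(P) = heegnerPointComplex Dt H`, and the crux's degree-one prime `𝔭 ∣ 3` with its embedding `embAt K 3 𝔭 : K →+* ℚ_3` —
suppose `G/ℚ` (globally minimal, `N_G ≠ 0`) is CONGRUENT to `W` mod `3` (`a_ℓ(W) ≡ a_ℓ(G) (mod 3)` for every prime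
`ℓ ∤ 3N_WN_G`), `K` is Heegner for `N_G`, `D′`, `H′`, `P′` are a parametrisation, a Heegner datum and the Heegner
point of `G` over `K` (`ι(P′) = heegnerPointComplex D′ H′`), the `G`-side Euler-depleted normalised logarithm
`e_G·log_{ω_G}P′/c_G` is a `3`-adic UNIT, and `‖e_W‖₃ ≤ 1`. Then Kriz–Li Thm. 1.16 (`h116`, the tree's named fact,
`m = 1`) gives `‖log_{ω_W}P / c(Dt)‖₃ ≥ 1`: the `W`-datum is L-idle. (`logOmega = Castella2018.padicLogOmega` and
`Dt.maninConstant = Dt.c` by `rfl`.)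
[cite: KrizLi2019, Thm. 1.16 with Rem. 1.17 and the sentence after Rem. 1.19 (Forum Math. Sigma 7 (2019) e15)] -/
theorem lIdle_of_thm116_of_congruentPartner (h116 : thm116_padicLogHeegner_congruence)
    (W : WeierstrassCurve ℚ) [W.IsElliptic] [W.IsGloballyMinimal] (N : ℕ) [NeZero N]
    (K : Type) [Field K] [NumberField K]
    (Dt : ModularParametrizationData W N) (H : HeegnerDatum N (NumberField.discr K)) (ι : K →+* ℂ)
    (P : (W.baseChange K).toAffine.Point)
    (hO6 : Additive.ClassO6 W 3) (hN : W.conductorNorm ℤ = N) (hK : IsImaginaryQuadratic K)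
    (hHg : SatisfiesHeegnerHypothesis N K)
    (hP : WeierstrassCurve.Affine.Point.map ι.toRatAlgHom P = heegnerPointComplex Dt H)
    (𝔭 : HeightOneSpectrum (𝓞 K)) (h𝔭 : ((3 : ℕ) : 𝓞 K) ∈ 𝔭.asIdeal)
    (he : 𝔭.asIdeal.ramificationIdx (𝓞 ℚ) = 1) (hf : 𝔭.asIdeal.inertiaDeg (𝓞 ℚ) = 1)
    (G : WeierstrassCurve ℚ) [G.IsElliptic] [G.IsGloballyMinimal] [NeZero (G.conductorNorm ℤ)]
    (hcong : ∀ ℓ : ℕ, ℓ.Prime → ¬ (ℓ ∣ 3 * W.conductorNorm ℤ * G.conductorNorm ℤ) →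
      ((W.LFunction ℓ : ℤ) : ZMod 3) = ((G.LFunction ℓ : ℤ) : ZMod 3))
    (D' : ModularParametrizationData G (G.conductorNorm ℤ))
    (hHG : SatisfiesHeegnerHypothesis (G.conductorNorm ℤ) K)
    (H' : HeegnerDatum (G.conductorNorm ℤ) (NumberField.discr K)) (P' : (G.baseChange K).toAffine.Point)
    (hP' : WeierstrassCurve.Affine.Point.map ι.toRatAlgHom P' = heegnerPointComplex D' H')
    (heW : ‖((eulerFactor 3 W G : ℚ) : ℚ_[3])‖ ≤ 1)
    (hunitG : ‖((eulerFactor 3 G W : ℚ) : ℚ_[3]) *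
        (Castella2018.padicLogOmega G 3 (embAt K 3 𝔭 h𝔭 he hf) P' / (D'.maninConstant : ℚ_[3]))‖ = 1) :
    1 ≤ ‖algebraMap ℚ_[3] ℂ_[3] (logOmega W 3 (embAt K 3 𝔭 h𝔭 he hf) P / (Dt.c : ℚ_[3]))‖ := by
  subst hN
  haveI : Fact (Nat.Prime 3) := ⟨Nat.prime_three⟩
  -- `3 ∣ N(E)` (additive at `3`), so `3` splits in the Heegner field `K`
  have h3N : 3 ∣ W.conductorNorm ℤ :=
    (W.dvd_conductorNorm_iff_not_hasGoodReductionAtPrime 3).mpr (not_good_of_addv W 3 hO6.2.1)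
  have hsplit : ((Ideal.span {((3 : ℕ) : ℤ)}).primesOver (𝓞 K)).ncard = 2 := hHg 3 Nat.prime_three h3N
  obtain ⟨ε, hε, hle⟩ := h116 3 W G hcong Dt D' K hK hHg hHG hsplit H H' ι (embAt K 3 𝔭 h𝔭 he hf)
    P P' hP hP'
  -- the `W`-side depleted logarithm has norm `≥ 1`, hence so does `log_ω P / c`
  have hX : 1 ≤ ‖((eulerFactor 3 W G : ℚ) : ℚ_[3]) *
      (Castella2018.padicLogOmega W 3 (embAt K 3 𝔭 h𝔭 he hf) P / (Dt.maninConstant : ℚ_[3]))‖ :=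
    one_le_norm_of_norm_sub_mul_le_inv hε hunitG hle
  have hz : 1 ≤ ‖Castella2018.padicLogOmega W 3 (embAt K 3 𝔭 h𝔭 he hf) P / (Dt.maninConstant : ℚ_[3])‖ :=
    one_le_norm_of_norm_le_one_of_one_le_norm_mul heW hX
  have hrw : logOmega W 3 (embAt K 3 𝔭 h𝔭 he hf) P / (Dt.c : ℚ_[3]) =
      Castella2018.padicLogOmega W 3 (embAt K 3 𝔭 h𝔭 he hf) P / (Dt.maninConstant : ℚ_[3]) := rfl
  rw [norm_algebraMap', hrw]
  exact hz

/-! ### §3 The crux's conclusion at that datum, for every frame -/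

/-- **`E_𝟙^V` at a datum with a congruence certificate.** Under the hypotheses of
`lIdle_of_thm116_of_congruentPartner`, the conclusion of `WildSplitEisensteinValueAtOneV` holds at the datum for EVERY
anticyclotomic frame (the crux's binders from `κ` on, VERBATIM; the cell binders `ρ̄₃` onto, `r_an = 1`,
`L(E^(d_K),1) ≠ 0`, `P` non-torsion, `d_K` odd are carried unused, as the crux carries them): by §2 the datum is
L-idle, and p626684's `valueAtOneV_on_lIdle` needs nothing else. Conditional on the refereed fact `h116` only.
[cite: KrizLi2019, Thm. 1.16 with Rem. 1.17 (Forum Math. Sigma 7 (2019) e15)] -/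
theorem valueAtOneV_datum_of_thm116_of_congruentPartner (h116 : thm116_padicLogHeegner_congruence)
    (W : WeierstrassCurve ℚ) [W.IsElliptic] [W.IsGloballyMinimal] (N : ℕ) [NeZero N]
    (K : Type) [Field K] [NumberField K]
    (Dt : ModularParametrizationData W N) (H : HeegnerDatum N (NumberField.discr K)) (ι : K →+* ℂ)
    (P : (W.baseChange K).toAffine.Point)
    (hO6 : Additive.ClassO6 W 3) (hsurj : W.HasSurjectiveModNGaloisRep 3) (hr : W.analyticRank = 1)
    (hN : W.conductorNorm ℤ = N) (hK : IsImaginaryQuadratic K) (hHg : SatisfiesHeegnerHypothesis N K)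
    (hLt : (W.quadraticTwist (NumberField.discr K : ℚ)).entireLFunction 1 ≠ 0)
    (hP : WeierstrassCurve.Affine.Point.map ι.toRatAlgHom P = heegnerPointComplex Dt H)
    (hnt : ¬ IsOfFinAddOrder P) (hodd : Odd (NumberField.discr K))
    (G : WeierstrassCurve ℚ) [G.IsElliptic] [G.IsGloballyMinimal] [NeZero (G.conductorNorm ℤ)]
    (hcong : ∀ ℓ : ℕ, ℓ.Prime → ¬ (ℓ ∣ 3 * W.conductorNorm ℤ * G.conductorNorm ℤ) →
      ((W.LFunction ℓ : ℤ) : ZMod 3) = ((G.LFunction ℓ : ℤ) : ZMod 3))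
    (D' : ModularParametrizationData G (G.conductorNorm ℤ))
    (hHG : SatisfiesHeegnerHypothesis (G.conductorNorm ℤ) K)
    (H' : HeegnerDatum (G.conductorNorm ℤ) (NumberField.discr K)) (P' : (G.baseChange K).toAffine.Point)
    (hP' : WeierstrassCurve.Affine.Point.map ι.toRatAlgHom P' = heegnerPointComplex D' H')
    (heW : ‖((eulerFactor 3 W G : ℚ) : ℚ_[3])‖ ≤ 1)
    (hunitG : ∀ (𝔭 : HeightOneSpectrum (𝓞 K)) (h𝔭 : ((3 : ℕ) : 𝓞 K) ∈ 𝔭.asIdeal)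
      (he : 𝔭.asIdeal.ramificationIdx (𝓞 ℚ) = 1) (hf : 𝔭.asIdeal.inertiaDeg (𝓞 ℚ) = 1),
      ‖((eulerFactor 3 G W : ℚ) : ℚ_[3]) *
        (Castella2018.padicLogOmega G 3 (embAt K 3 𝔭 h𝔭 he hf) P' / (D'.maninConstant : ℚ_[3]))‖ = 1) :
    ∀ (κ : Literature.NumberTheory.EllipticCurves.ZpExtension K 3), κ.IsAnticyclotomic → ∀ (γ : Field.absoluteGaloisGroup K) [Fact (κ.IsTopGenerator γ)] (𝔭 : IsDedekindDomain.HeightOneSpectrum (NumberField.RingOfIntegers K)) (h𝔭 : ((3 : ℕ) : NumberField.RingOfIntegers K) ∈ 𝔭.asIdeal) (he : 𝔭.asIdeal.ramificationIdx (NumberField.RingOfIntegers ℚ) = 1) (hf : 𝔭.asIdeal.inertiaDeg (NumberField.RingOfIntegers ℚ) = 1), ∀ (𝔭' : IsDedekindDomain.HeightOneSpectrum (NumberField.RingOfIntegers K)), ((3 : ℕ) : NumberField.RingOfIntegers K) ∈ 𝔭'.asIdeal → 𝔭' ≠ 𝔭 → ∀ (ι' : PadicAlgCl 3 ≃+* ℂ),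 Summit.BirchSwinnertonDyer.BirchSwinnertonDyer.Theorems.SchneiderFree.BranchInducesPrime 3 ι' 𝔭 → ∀ (ΩK : ℂ) (Ωp : ℂ_[3]) (L : Literature.NumberTheory.EllipticCurves.UnrSeries 3), ΩK ≠ 0 → Ωp ≠ 0 → Literature.NumberTheory.EllipticCurves.IsBDPLFunction ι' 𝔭 κ γ Dt.f ΩK Ωp L → Module.IsTorsion (Literature.NumberTheory.EllipticCurves.IwasawaAlgebra 3) (Summit.BirchSwinnertonDyer.Rank1Residual.X11b.AcSelmer.XAc (W.baseChange K) 3 κ 𝔭' ∅ γ) → ∀ (u : (Literature.NumberTheory.EllipticCurves.unrIntegers 3)ˣ), L.HasValueAt 0 ((((u : Literature.NumberTheory.EllipticCurves.unrIntegers 3) : Literature.NumberTheory.EllipticCurves.unrIntegers 3) : ℂ_[3]) * (algebraMap ℚ_[3] ℂ_[3] (Summit.BirchSwinnertonDyer.Rank1Residual.X11b.Halves.logOmega W 3 (Summit.BirchSwinnertonDyer.Rank1Residual.X11b.embAt K 3 𝔭 h𝔭 he hf) P / (Dt.c : ℚ_[3]))) ^ 2) → ∀ (f : Literature.NumberTheory.EllipticCurves.IwasawaAlgebra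 3), Summit.BirchSwinnertonDyer.Rank1Residual.X11b.AcSelmer.XAc.charIdeal (W.baseChange K) 3 κ 𝔭' ∅ γ = Ideal.span {f} → ‖((PowerSeries.constantCoeff f : ℤ_[3]) : ℚ_[3])‖ ≤ ‖((PowerSeries.constantCoeff L : Literature.NumberTheory.EllipticCurves.unrIntegers 3) : ℂ_[3])‖ := by
  intro κ hκ γ _ 𝔭 h𝔭 he hf 𝔭' h𝔭' hne ι' hbr ΩK Ωp L hΩK hΩp hBDP htors u hval f hfg
  exact WildSplitEisensteinValueAtOneVLIdle.valueAtOneV_on_lIdle W N K Dt H ι P hO6 hsurj hr hN hK hHg hLt hP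
    hnt hodd κ hκ γ 𝔭 h𝔭 he hf 𝔭' h𝔭' hne ι' hbr ΩK Ωp L hΩK hΩp hBDP htors u hval
    (lIdle_of_thm116_of_congruentPartner h116 W N K Dt H ι P hO6 hN hK hHg hP 𝔭 h𝔭 he hf G hcong D' hHG
      H' P' hP' heW (hunitG 𝔭 h𝔭 he hf)) f hfg

/-! ### §4 The crux BY NAME from «congruence certificate or residue» at every datum -/

/-- **`E_𝟙^V` BY NAME from Kriz–Li Thm. 1.16 and a per-datum display «congruence certificate OR the inequality
itself».** Hypotheses: the named fact `h116`; and `hrow`: at every cell datum (the crux's binders up to `d_K` odd,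
verbatim) EITHER a congruence certificate (a mod-`3` congruent partner `G` Heegner for `K` with a `G`-side unit bit at
every degree-one `𝔭 ∣ 3` and `‖e_W‖₃ ≤ 1`) OR the crux's own conclusion for every frame (displayed, the residue).
Pure logic over §3. Every input is an antecedent; nothing is asserted about any curve; NOT a class-wide engine (the
second disjunct is the research content on the L-excess data). [cite: KrizLi2019, Thm. 1.16 with Rem. 1.17 (Forum Math. Sigma 7 (2019) e15)] -/
theorem valueAtOneV_of_thm116_of_certificate_or_residue (h116 : thm116_padicLogHeegner_congruence)
    (hrow : ∀ (W : WeierstrassCurve ℚ) [W.IsElliptic] [W.IsGloballyMinimal] (N : ℕ) [NeZero N] (K : Type) [Field K] [NumberField K] (Dt : Literature.NumberTheory.EllipticCurves.ModularForms.ModularParametrizationData W N) (H : Literature.NumberTheory.EllipticCurves.HeegnerDatum N (NumberField.discr K)) (ι : K →+* ℂ) (P : (W.baseChange K).toAffine.Point), Summit.BirchSwinnertonDyer.Rank1Residual.Additive.ClassO6 W 3 → W.HasSurjectiveModNGaloisRep 3 → W.analyticRank = 1 → W.conductorNorm ℤ = N → Literature.NumberTheory.EllipticCurves.IsImaginaryQuadratic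 K → Literature.NumberTheory.EllipticCurves.SatisfiesHeegnerHypothesis N K → (W.quadraticTwist (NumberField.discr K : ℚ)).entireLFunction 1 ≠ 0 → (WeierstrassCurve.Affine.Point.map ι.toRatAlgHom) P = Literature.NumberTheory.EllipticCurves.ModularForms.heegnerPointComplex Dt H → ¬ IsOfFinAddOrder P → Odd (NumberField.discr K) → ((∃ (G : WeierstrassCurve ℚ) (_ : G.IsElliptic) (_ : G.IsGloballyMinimal) (_ : NeZero (G.conductorNorm ℤ)) (D' : Literature.NumberTheory.EllipticCurves.ModularForms.ModularParametrizationData G (G.conductorNorm ℤ)) (H' : Literature.NumberTheory.EllipticCurves.HeegnerDatum (G.conductorNorm ℤ) (NumberField.discr K)) (P' : (G.baseChange K).toAffine.Point), (∀ ℓ : ℕ, ℓ.Prime → ¬ (ℓ ∣ 3 * W.conductorNorm ℤ * G.conductorNorm ℤ) → ((W.LFunction ℓ : ℤ) : ZMod 3) = ((G.LFunction ℓ : ℤ) : ZMod 3)) ∧ Literature.NumberTheory.EllipticCurves.SatisfiesHeegnerHypothesis (G.conductorNorm ℤ) K ∧ (WeierstrassCurve.Affine.Point.map ι.toRatAlgHom)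 P' = Literature.NumberTheory.EllipticCurves.ModularForms.heegnerPointComplex D' H' ∧ ‖((Literature.NumberTheory.EllipticCurves.KrizLi2019.eulerFactor 3 W G : ℚ) : ℚ_[3])‖ ≤ 1 ∧ (∀ (𝔭 : IsDedekindDomain.HeightOneSpectrum (NumberField.RingOfIntegers K)) (h𝔭 : ((3 : ℕ) : NumberField.RingOfIntegers K) ∈ 𝔭.asIdeal) (he : 𝔭.asIdeal.ramificationIdx (NumberField.RingOfIntegers ℚ) = 1) (hf : 𝔭.asIdeal.inertiaDeg (NumberField.RingOfIntegers ℚ) = 1), ‖((Literature.NumberTheory.EllipticCurves.KrizLi2019.eulerFactor 3 G W : ℚ) : ℚ_[3]) * (Literature.NumberTheory.EllipticCurves.Castella2018.padicLogOmega G 3 (Summit.BirchSwinnertonDyer.Rank1Residual.X11b.embAt K 3 𝔭 h𝔭 he hf) P' / (D'.maninConstant : ℚ_[3]))‖ = 1)) ∨ (∀ (κ : Literature.NumberTheory.EllipticCurves.ZpExtension K 3), κ.IsAnticyclotomic → ∀ (γ : Field.absoluteGaloisGroup K) [Fact (κ.IsTopGenerator γ)] (𝔭 : IsDedekindDomain.HeightOneSpectrum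 (NumberField.RingOfIntegers K)) (h𝔭 : ((3 : ℕ) : NumberField.RingOfIntegers K) ∈ 𝔭.asIdeal) (he : 𝔭.asIdeal.ramificationIdx (NumberField.RingOfIntegers ℚ) = 1) (hf : 𝔭.asIdeal.inertiaDeg (NumberField.RingOfIntegers ℚ) = 1), ∀ (𝔭' : IsDedekindDomain.HeightOneSpectrum (NumberField.RingOfIntegers K)), ((3 : ℕ) : NumberField.RingOfIntegers K) ∈ 𝔭'.asIdeal → 𝔭' ≠ 𝔭 → ∀ (ι' : PadicAlgCl 3 ≃+* ℂ), Summit.BirchSwinnertonDyer.BirchSwinnertonDyer.Theorems.SchneiderFree.BranchInducesPrime 3 ι' 𝔭 → ∀ (ΩK : ℂ) (Ωp : ℂ_[3]) (L : Literature.NumberTheory.EllipticCurves.UnrSeries 3), ΩK ≠ 0 → Ωp ≠ 0 → Literature.NumberTheory.EllipticCurves.IsBDPLFunction ι' 𝔭 κ γ Dt.f ΩK Ωp L → Module.IsTorsion (Literature.NumberTheory.EllipticCurves.IwasawaAlgebra 3) (Summit.BirchSwinnertonDyer.Rank1Residual.X11b.AcSelmer.XAc (W.baseChange K) 3 κ 𝔭'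 ∅ γ) → ∀ (u : (Literature.NumberTheory.EllipticCurves.unrIntegers 3)ˣ), L.HasValueAt 0 ((((u : Literature.NumberTheory.EllipticCurves.unrIntegers 3) : Literature.NumberTheory.EllipticCurves.unrIntegers 3) : ℂ_[3]) * (algebraMap ℚ_[3] ℂ_[3] (Summit.BirchSwinnertonDyer.Rank1Residual.X11b.Halves.logOmega W 3 (Summit.BirchSwinnertonDyer.Rank1Residual.X11b.embAt K 3 𝔭 h𝔭 he hf) P / (Dt.c : ℚ_[3]))) ^ 2) → ∀ (f : Literature.NumberTheory.EllipticCurves.IwasawaAlgebra 3), Summit.BirchSwinnertonDyer.Rank1Residual.X11b.AcSelmer.XAc.charIdeal (W.baseChange K) 3 κ 𝔭' ∅ γ = Ideal.span {f} → ‖((PowerSeries.constantCoeff f : ℤ_[3]) : ℚ_[3])‖ ≤ ‖((PowerSeries.constantCoeff L : Literature.NumberTheory.EllipticCurves.unrIntegers 3) : ℂ_[3])‖))) :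
    WildSplitEisensteinValueAtOneV := by
  intro W _ _ N _ K _ _ Dt H ι P hO6 hsurj hr hN hK hHg hLt hP hnt hodd κ hκ γ _ 𝔭 h𝔭 he hf 𝔭' h𝔭' hne ι' hbr ΩK
    Ωp L hΩK hΩp hBDP htors u hval f hfg
  rcases hrow W N K Dt H ι P hO6 hsurj hr hN hK hHg hLt hP hnt hodd with
    ⟨G, hGe, hGm, hGn, D', H', P', hcong, hHG, hP', heW, hunitG⟩ | hres
  · haveI := hGe; haveI := hGm; haveI := hGn
    exact valueAtOneV_datum_of_thm116_of_congruentPartner h116 W N K Dt H ι P hO6 hsurj hr hN hK hHg hLt hP hnt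
      hodd G hcong D' hHG H' P' hP' heW hunitG κ hκ γ 𝔭 h𝔭 he hf 𝔭' h𝔭' hne ι' hbr ΩK Ωp L hΩK hΩp hBDP htors u
      hval f hfg
  · exact hres κ hκ γ 𝔭 h𝔭 he hf 𝔭' h𝔭' hne ι' hbr ΩK Ωp L hΩK hΩp hBDP htors u hval f hfg

end Summit.BirchSwinnertonDyer.BirchSwinnertonDyer.Theorems.WildSplitEisensteinValueAtOneVKrizLiTransport

end
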